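import Literature.Analysis.Complex.SeparatelyHolomorphicStrips
import HarnessLib

/-!
# The bounded cross theorem for two strips, as a named fact (`DiamondCross`) with its discharge

Topic `Literature/Analysis/Complex`. This is the home (librarian move, 2026-08-16, standing duty
"Uncategorized") of the named fact formerly parked by the gate at
`Literature.Uncategorized.DiamondCross` (`Literature/Uncategorized/DiamondCross.lean`, accept-time
relocation out of a `Summits/CriticalPhenomena/Ising3DConformalLimit/Theorems/` proposal)
together with its discharge
`Literature.Uncategorized.DiamondCross_holds` (`…/DiamondCrossHolds.lean`). Statement and proof are
byte-identical; only the namespace (= this directory) is new, and the three quantum-field-theory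
imports of the parked file (unused by the statement) are replaced by the one file that proves it.
The old names stay behind as deprecated aliases.

* `Literature.Analysis.Complex.DiamondCross` — THE BOUNDED CROSS THEOREM FOR TWO STRIPS
  (Bernstein 1912 / Siciak 1969 / Zahariuta 1976; Jarnicki–Pflug 2011, Ch. 5): a function of two
  real variables that is, separately in each variable, the trace of a function holomorphic and
  bounded by `M` on the strip `{|Im| < b}` is the trace of ONE function holomorphic and bounded by
  `M` on the diamond tube `{|Im z| + |Im w| < b}`.
* `Literature.Analysis.Complex.DiamondCross_holds` — its proof, which is the tree theorem
  `Literature.Analysis.Complex.exists_holomorphic_extension_diamond_of_separately`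
  (`SeparatelyHolomorphicStrips.lean`: Vitali, partial Fourier transform with Paley–Wiener decay,
  Phragmén–Lindelöf on the strip, Fourier–Laplace synthesis, power trick for the sharp bound).

## References

* M. Jarnicki, P. Pflug, *Separately Analytic Functions*, EMS Tracts in Mathematics 16 (2011),
  Ch. 5 (classical cross theorem with estimate). [JarnickiPflug2011]
-/

namespace Literature.Analysis.Complex

/-- THE BOUNDED CROSS THEOREM FOR TWO STRIPS (Bernstein 1912 / Siciak 1969 / Zahariuta 1976
with the relative extremal function `h_{ℝ,S_b}(z) = |Im z|/b`; Jarnicki–Pflug 2011): a function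
`F` of two real variables which for every real `y` is the restriction of a function holomorphic
and bounded by `M` on the strip `|Im z| < b`, and for every real `x` likewise in the second
variable, is the restriction of ONE function holomorphic on the diamond tube
`{|Im z| + |Im w| < b}` and bounded by `M` there. (Stated verbatim as in the line
`bisector-cross-light-cone` of `Summits/CriticalPhenomena/Ising3DConformalLimit`, stub
`stub_diamondCross`; proved below.)
[cite: JarnickiPflug2011, Ch. 5 (classical cross theorem with estimate)] -/
def DiamondCross : Prop :=
  ∀ (b M : ℝ) (F : ℝ → ℝ → ℂ), 0 < b →
    (∀ y : ℝ, ∃ g : ℂ → ℂ, DifferentiableOn ℂ g {z : ℂ | |z.im| < b} ∧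
      (∀ z : ℂ, |z.im| < b → ‖g z‖ ≤ M) ∧ ∀ x : ℝ, g x = F x y) →
    (∀ x : ℝ, ∃ h : ℂ → ℂ, DifferentiableOn ℂ h {w : ℂ | |w.im| < b} ∧
      (∀ w : ℂ, |w.im| < b → ‖h w‖ ≤ M) ∧ ∀ y : ℝ, h y = F x y) →
    ∃ G : ℂ × ℂ → ℂ, DifferentiableOn ℂ G {p : ℂ × ℂ | |p.1.im| + |p.2.im| < b} ∧
      (∀ p : ℂ × ℂ, |p.1.im| + |p.2.im| < b → ‖G p‖ ≤ M) ∧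
      ∀ x y : ℝ, G ((x : ℂ), (y : ℂ)) = F x y

/-- **Discharge of `DiamondCross`** (the bounded cross theorem for two strips; Bernstein 1912,
Siciak 1969, Zahariuta 1976; Jarnicki–Pflug, *Separately Analytic Functions*, EMS 2011, Ch. 5):
`DiamondCross` holds, by
`Literature.Analysis.Complex.exists_holomorphic_extension_diamond_of_separately`.
[cite: JarnickiPflug2011, Ch. 5 (classical cross theorem with estimate)] -/
theorem DiamondCross_holds : DiamondCross := fun _b _M _F hb hg hh =>
  exists_holomorphic_extension_diamond_of_separately hb hg hh

end Literature.Analysis.Complex
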